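import Summits.BirchSwinnertonDyer.BirchSwinnertonDyer.Theorems.PrintX10bReadoutIndexOfLocalClauses
import Literature.NumberTheory.EllipticCurves.ZpExtensionEisensteinGradedPrincipalConditionProofs
import Literature.NumberTheory.EllipticCurves.ZpExtensionEisensteinOrdinaryCoreSaturationIndexProofs
import Literature.NumberTheory.GaloisCohomology.Howard2004.CondAComapIndexProofs
import Literature.NumberTheory.EllipticCurves.ZpExtensionEisensteinTwistLocalH1UniformCardProofs
import Literature.NumberTheory.EllipticCurves.AnticyclotomicHeegnerPlacesDecompositionProofs
import Literature.NumberTheory.EllipticCurves.AnticyclotomicInertiaAboveP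
import Literature.NumberTheory.EllipticCurves.IwasawaSelmerOrdinaryProofs
import Literature.NumberTheory.EllipticCurves.OrdinaryReductionAscentProofs
import Literature.NumberTheory.EllipticCurves.TorsionFilAtCyclicOfFrobeniusTraceProofs
import Summits.BirchSwinnertonDyer.BirchSwinnertonDyer.Theorems.PrintX10bStubReadoutLocalIndexP
import Literature.NumberTheory.EllipticCurves.ZpExtensionEisensteinGradedInvariantsBoundMultiplicativeThreeProofs
import Literature.NumberTheory.EllipticCurves.ZpExtensionEisensteinOrdinaryCoreSaturationIndexMultiplicativeThreeProofs
import HarnessLib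

/-!
# (B5-P) — the relaxed, level-shifted local condition at a place `v ∣ 3` of MULTIPLICATIVE reduction with
# `#(Fv ⧸ condA_j(v) ∩ Fv) ≤ 3^{2·3^s}` (helper, THEOREMS ONLY: no definition, no named fact, no instance, no `sorry`)

Helper toward the registered stub `stub_howardOutputsOfFamily` (K2) of line `beta-road` (skeleton v10 cd44fe9d5c6b9a78) of crux r205
stmt-BirchSwinnertonDyer-24737 `…Theses.UniversalToricDescent.TwinAlgMuZeroAtThree` (LEAD lineage `bsd-wall-utd-p1`, g25): readout side of
the twin's E2/D1 assembly.  x10b-p1-w7's per-place theorem `HeegnerMuPartControlGlue.readoutLocalIndexP_at`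
(`Theorems/PrintX10bStubReadoutLocalIndexP` §2, the second place-wise clause of `readoutIndex_of_localClauses`) at `p = 3` for a place of
MULTIPLICATIVE reduction: statement and proof verbatim with `(hgood, hord)` replaced by `hmult`, the two local inputs being
`exists_int_scalar_torsionFilAt_of_hasMultiplicativeReductionAt_three` (p759558) and
`natCard_ordinaryCore_quotient_levelCondition_le_of_hasMultiplicativeReductionAt_three` (p759821).  The frame-level closer (§3 of x10b's
file, ControlGlue letter `Stmt.readoutLocalIndexP`) is left to the twin's ControlGlue assembly.  No summit statement is proved; BSD is not
proved by any of this.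
-/

set_option linter.dupNamespace false
set_option autoImplicit false

noncomputable section

open scoped Classical Pointwise ContRepresentation TensorProduct NumberField

open Function NumberField IsDedekindDomain Field
open Literature Literature.NumberTheory.EllipticCurves WeierstrassCurve
open Literature.NumberTheory.GaloisCohomology Literature.NumberTheory.GaloisCohomology.Howard2004
open Literature.NumberTheory.GaloisRepresentations Literature.NumberTheory.GaloisRepresentations.DiscreteGaloisModule
open Literature.NumberTheory.EllipticCurves.GreenbergSelmer
open Summit.BirchSwinnertonDyer.BirchSwinnertonDyer.Theorems
open Literature.NumberTheory.EllipticCurves.ZpExtension (EisensteinLevel)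

namespace Summit.BirchSwinnertonDyer.BirchSwinnertonDyer.Theorems.UniversalToricDescentTwinReadoutLocalIndexThree

/-! ## The per-place statement (B5-P) on Howard's tower of the curve at a MULTIPLICATIVE `v ∣ 3` (generic tower binders, St-free) -/

set_option maxHeartbeats 800000 in
/-- **(B5-P) at one place `v ∣ p` and one level `j`** on Howard's tower `T^{(k)} = E_K[p^{k+1}] ⊗ A_{m,k+1}(ψ⁻¹)`
(`W.eisensteinTower (κ.unitTwist (-1)) hm`, generic tower binders `π e hkill hker hπ he hπX hek`, any family of local conditions
`F` which at `v` is Howard's saturated ordinary level condition `F_𝔮(v)`): given `σ₀ ∈ Γ_{K_v}` with `κ⁻¹(σ₀) = p^s`, `p^s < m`,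
and the (hS′) input «for some shift `d`, Selmer readout ⇒ the `d`-shifted localisation has graded readout principal on
`res⁻¹(ker κ)`» (x10b-p1-w6 g4), the relaxed condition `Fv := F′.comap (incLocIter j (inr v) d)` contains `loc_v c` for every
such `c` and `#(Fv ⧸ condA F j v ∩ Fv) ≤ p^{2p^s}` (`[F′ : core] ≤ p^{p^s}` by `exists_addSubgroup_gradedPrincipal`,
`[core : core ∩ F_𝔮] ≤ p^{p^s}` by `natCard_ordinaryCore_quotient_levelCondition_le`, `condA ⊇ F_𝔮.comap` by
`finite_and_natCard_comap_incLocIter_quotient_condA_le`).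
[cite: Howard2004HeegnerKolyvagin, Lemma 2.2.7 / Prop. 2.2.8, Lemma 3.2.7 and proof of Thm. 2.2.10 (arXiv:1202.6340 p. 16–18)]
[cite: GreenbergLNM1716, §2–§3] [cite: MilneADT2006, I Cor. 2.3] -/
theorem readoutLocalIndexThree_at_of_hasMultiplicativeReductionAt {K : Type} [Field K] [NumberField K] (W : WeierstrassCurve ℚ)
    [W.IsElliptic] (κ : ZpExtension K 3) {m : ℕ} (hm : 1 ≤ m)
    (π : (IwasawaAlgebra 3 ⧸ Ideal.span {(PowerSeries.X ^ m + PowerSeries.C ((3 : ℕ) : ℤ_[3]) : IwasawaAlgebra 3)})) (e : ℕ → ℕ)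
    (hkill : letI := IwasawaAlgebra.isLocalRing_quotient_X_pow_add_C 3 hm
      ∀ k, ∀ r ∈ IsLocalRing.maximalIdeal (IwasawaAlgebra 3 ⧸ Ideal.span {(PowerSeries.X ^ m + PowerSeries.C ((3 : ℕ) : ℤ_[3]) : IwasawaAlgebra 3)}) ^ e k,
        ∀ x : EisensteinLevel 3 m (fun j ↦ geomTorsion (W.baseChange K) (((3 : ℕ) : ℤ) ^ j)) (k + 1), r • x = 0)
    (hker : letI := IwasawaAlgebra.isLocalRing_quotient_X_pow_add_C 3 hm
      ∀ k, LinearMap.ker ((W.eisensteinTower (κ.unitTwist (-1)) hm).red k) =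
        (IsLocalRing.maximalIdeal (IwasawaAlgebra 3 ⧸ Ideal.span {(PowerSeries.X ^ m + PowerSeries.C ((3 : ℕ) : ℤ_[3]) : IwasawaAlgebra 3)}) ^ e k) •
          (⊤ : Submodule (IwasawaAlgebra 3 ⧸ Ideal.span {(PowerSeries.X ^ m + PowerSeries.C ((3 : ℕ) : ℤ_[3]) : IwasawaAlgebra 3)}) (EisensteinLevel 3 m (fun j ↦ geomTorsion (W.baseChange K) (((3 : ℕ) : ℤ) ^ j)) (k + 1 + 1))))
    (hπ : letI := IwasawaAlgebra.isLocalRing_quotient_X_pow_add_C 3 hm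
      π ∈ IsLocalRing.maximalIdeal (IwasawaAlgebra 3 ⧸ Ideal.span {(PowerSeries.X ^ m + PowerSeries.C ((3 : ℕ) : ℤ_[3]) : IwasawaAlgebra 3)}))
    (he : ∀ k, e k ≤ e (k + 1)) (hπX : π = Ideal.Quotient.mk _ PowerSeries.X) (hek : ∀ k, e (k + 1) - e k = m)
    (F : letI := IwasawaAlgebra.isLocalRing_quotient_X_pow_add_C 3 hm
      ∀ k, SelmerStructure ((W.eisensteinTower (κ.unitTwist (-1)) hm).ρ k))
    (v : HeightOneSpectrum (𝓞 K)) (hpv : ((3 : ℕ) : 𝓞 K) ∈ v.asIdeal) (hmult : (W.baseChange K).HasMultiplicativeReductionAt v)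
    (σ₀ : absoluteGaloisGroup (v.adicCompletion K)) {s : ℕ}
    (hσ₀ : ((κ.unitTwist (-1)) (absGaloisRestrict K (v.adicCompletion K) σ₀)).toAdd = ((3 ^ s : ℕ) : ℤ_[3]))
    (hms : 3 ^ s < m) (j : ℕ)
    (hF : letI := IwasawaAlgebra.isLocalRing_quotient_X_pow_add_C 3 hm
      ∀ k, F k (Sum.inr v) = Tower.levelCondition ((κ.unitTwist (-1)).eisensteinLocalReduce (fun i ↦ (W.baseChange K).torsionGaloisModule (((3 : ℕ) : ℤ) ^ i))
        (fun i ↦ (W.baseChange K).torsionGaloisModuleReduce 3 i) hm (Sum.inr v)) 3 (fun i ↦ ((W.baseChange K).ordinaryFiltrationAt v (fun i ↦ (W.baseChange K).torsionGaloisModuleReduce 3 i) (fun _ _ ↦ rfl)).ordinaryCore (κ := κ.unitTwist (-1)) hm i) (k + 1))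
    (hSv : letI := IwasawaAlgebra.isLocalRing_quotient_X_pow_add_C 3 hm
      ∃ d : ℕ, ∀ (k : ℕ) (c : galoisCohomology ((W.eisensteinTower (κ.unitTwist (-1)) hm).ρ k) 1),
        W.eisensteinTowerReadout κ hm π e hkill hker hπ he hπX hek
          (AddCommGroup.DirectLimit.of (fun k ↦ galoisCohomology ((W.eisensteinTower (κ.unitTwist (-1)) hm).ρ k) 1)
            (AdicTower.incH1LE (W.eisensteinTower (κ.unitTwist (-1)) hm) π e hkill hker hπ he) k c) ∈ (W.baseChange K).selmerInfty κ →
        ∃ φ : contOneCocycles ((GaloisRep.toLocal v ((κ.unitTwist (-1)).eisensteinTwist ((W.baseChange K).torsionGaloisModule (((3 : ℕ) : ℤ) ^ (k + d + 1))) hm (k + d + 1))).quotient (((W.baseChange K).ordinaryFiltrationAt v (fun i ↦ (W.baseChange K).torsionGaloisModuleReduce 3 i) (fun _ _ ↦ rfl)).twistedFil (k + d + 1)) (((W.baseChange K).ordinaryFiltrationAt v (fun i ↦ (W.baseChange K).torsionGaloisModuleReduce 3 i) (fun _ _ ↦ rfl)).twistedFil_le_comap hm (k + d + 1))).toTopR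ep,
          oneCocycleClass _ φ = DiscreteGaloisModule.quotientMap (GaloisRep.toLocal v ((κ.unitTwist (-1)).eisensteinTwist ((W.baseChange K).torsionGaloisModule (((3 : ℕ) : ℤ) ^ (k + d + 1))) hm (k + d + 1)))
            (((W.baseChange K).ordinaryFiltrationAt v (fun i ↦ (W.baseChange K).torsionGaloisModuleReduce 3 i) (fun _ _ ↦ rfl)).twistedFil (k + d + 1)) (((W.baseChange K).ordinaryFiltrationAt v (fun i ↦ (W.baseChange K).torsionGaloisModuleReduce 3 i) (fun _ _ ↦ rfl)).twistedFil_le_comap hm (k + d + 1)) 1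
            (AdicTower.incLocIter (W.eisensteinTower (κ.unitTwist (-1)) hm) π e hkill hker hπ he k (Sum.inr v) d
              (galoisCohomology.localization ((W.eisensteinTower (κ.unitTwist (-1)) hm).ρ k) (Sum.inr v) 1 c)) ∧
          ∃ q₀ : IwasawaAlgebra.EisensteinCoeff.Twisted 3 m (k + d + 1) (geomTorsion (W.baseChange K) (((3 : ℕ) : ℤ) ^ (k + d + 1))) ⧸
              ((W.baseChange K).ordinaryFiltrationAt v (fun i ↦ (W.baseChange K).torsionGaloisModuleReduce 3 i) (fun _ _ ↦ rfl)).twistedFil (k + d + 1),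
            ∀ σ : absoluteGaloisGroup (v.adicCompletion K), absGaloisRestrict K (v.adicCompletion K) σ ∈ κ.kerSubgroup →
              φ.1 σ = ((GaloisRep.toLocal v ((κ.unitTwist (-1)).eisensteinTwist ((W.baseChange K).torsionGaloisModule (((3 : ℕ) : ℤ) ^ (k + d + 1))) hm (k + d + 1))).quotient (((W.baseChange K).ordinaryFiltrationAt v (fun i ↦ (W.baseChange K).torsionGaloisModuleReduce 3 i) (fun _ _ ↦ rfl)).twistedFil (k + d + 1)) (((W.baseChange K).ordinaryFiltrationAt v (fun i ↦ (W.baseChange K).torsionGaloisModuleReduce 3 i) (fun _ _ ↦ rfl)).twistedFil_le_comap hm (k + d + 1))) σ q₀ - q₀) :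
    letI := IwasawaAlgebra.isLocalRing_quotient_X_pow_add_C 3 hm
    ∃ Fv : AddSubgroup (galoisCohomology (((W.eisensteinTower (κ.unitTwist (-1)) hm).ρ j).toLocal (Sum.inr v)) 1),
      (∀ c : galoisCohomology ((W.eisensteinTower (κ.unitTwist (-1)) hm).ρ j) 1,
        W.eisensteinTowerReadout κ hm π e hkill hker hπ he hπX hek
          (AddCommGroup.DirectLimit.of (fun k ↦ galoisCohomology ((W.eisensteinTower (κ.unitTwist (-1)) hm).ρ k) 1)
            (AdicTower.incH1LE (W.eisensteinTower (κ.unitTwist (-1)) hm) π e hkill hker hπ he) j c) ∈ (W.baseChange K).selmerInfty κ →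
          galoisCohomology.localization ((W.eisensteinTower (κ.unitTwist (-1)) hm).ρ j) (Sum.inr v) 1 c ∈ Fv) ∧
      Finite (↥Fv ⧸ (AdicTower.condA (W.eisensteinTower (κ.unitTwist (-1)) hm) π e hkill hker hπ he F j (Sum.inr v)).addSubgroupOf Fv) ∧
      Nat.card (↥Fv ⧸ (AdicTower.condA (W.eisensteinTower (κ.unitTwist (-1)) hm) π e hkill hker hπ he F j (Sum.inr v)).addSubgroupOf Fv) ≤ 3 ^ (2 * 3 ^ s) := by
  letI := IwasawaAlgebra.isLocalRing_quotient_X_pow_add_C 3 hm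
  obtain ⟨d, hd⟩ := hSv
  -- finiteness of the level `n = j + d + 1`
  haveI hfinE : Finite (geomTorsion (W.baseChange K) (((3 : ℕ) : ℤ) ^ (j + d + 1))) :=
    finite_torsionPoints_holds (W.baseChange K) (AlgebraicClosure K) (n := ((3 : ℕ) : ℤ) ^ (j + d + 1))
      (pow_ne_zero _ (by exact_mod_cast Nat.prime_three.ne_zero))
  haveI hfinM : Finite (IwasawaAlgebra.EisensteinCoeff.Twisted 3 m (j + d + 1)
      (geomTorsion (W.baseChange K) (((3 : ℕ) : ℤ) ^ (j + d + 1)))) :=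
    IwasawaAlgebra.EisensteinCoeff.finite_twisted (p := 3) (k := j + d + 1)
      (M := geomTorsion (W.baseChange K) (((3 : ℕ) : ℤ) ^ (j + d + 1))) hm
  haveI hfinH := finite_galoisCohomology_one_toLocal ((κ.unitTwist (-1)).eisensteinTwist ((W.baseChange K).torsionGaloisModule (((3 : ℕ) : ℤ) ^ (j + d + 1))) hm (j + d + 1)) v
  -- scalar data of `Γ_{K_v}` on `gr_v E_K[p^n]`
  obtain ⟨n₀, Q₀, hn₀, hσn, hQ₀⟩ := (W.baseChange K).exists_int_scalar_torsionFilAt_of_hasMultiplicativeReductionAt_three v hpv hmult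
    (k := j + d + 1) (Nat.le_add_left 1 (j + d)) σ₀
  -- (δ): the relaxed condition `F′ ⊇ core` at level `n`, `[F′ : core] ≤ p^{p^s}`
  obtain ⟨F', hF', hcore, hfin₁, h₁⟩ :=
    ((W.baseChange K).ordinaryFiltrationAt v (fun i ↦ (W.baseChange K).torsionGaloisModuleReduce 3 i) (fun _ _ ↦ rfl)).exists_addSubgroup_gradedPrincipal (κ.unitTwist (-1)) hm (j + d + 1) σ₀ n₀ hn₀ hσn Q₀ hQ₀ hσ₀ hms
  -- (ε): `[core : core ∩ F_𝔮(v)_n] ≤ p^{p^s}`, `F_𝔮(v)_n = F (j + d) (inr v)` by `hF`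
  have h₂ := (W.baseChange K).natCard_ordinaryCore_quotient_levelCondition_le_of_hasMultiplicativeReductionAt_three (κ.unitTwist (-1)) hm v
    hpv hmult σ₀
    hσ₀ hms (j + d + 1)
  rw [← hF (j + d)] at h₂
  haveI := hfin₁
  haveI hfin₂ : Finite (↥(((W.baseChange K).ordinaryFiltrationAt v (fun i ↦ (W.baseChange K).torsionGaloisModuleReduce 3 i) (fun _ _ ↦ rfl)).ordinaryCore (κ := κ.unitTwist (-1)) hm (j + d + 1)) ⧸
      (F (j + d) (Sum.inr v)).addSubgroupOf _) :=
    Finite.of_surjective _ QuotientAddGroup.mk_surjective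
  -- (β): the shifted local index `#(Fv ⧸ condA ∩ Fv) ≤ p^{p^s} · p^{p^s}`, `Fv := F′.comap (incLocIter j (inr v) d)`
  obtain ⟨hfin, hcard⟩ := @AdicTower.finite_and_natCard_comap_incLocIter_quotient_condA_le _ _ _ _ _ _ _ _ _ _ _ (W.eisensteinTower (κ.unitTwist (-1)) hm) π e
    hkill hker hπ he F j (Sum.inr v) d F' _ hcore hfin₁ hfin₂ (3 ^ 3 ^ s) (3 ^ 3 ^ s) h₁ h₂
  refine ⟨F'.comap (AdicTower.incLocIter (W.eisensteinTower (κ.unitTwist (-1)) hm) π e hkill hker hπ he j (Sum.inr v) d), fun c hc ↦ ?_, hfin,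
    hcard.trans_eq ?_⟩
  · -- (hS′): Selmer readout ⇒ graded readout principal on `res⁻¹(ker κ)` after the shift
    rw [AddSubgroup.mem_comap]
    refine (hF' _).2 ?_
    obtain ⟨φ, hφ, q₀, hq₀⟩ := hd j c hc
    exact ⟨φ, hφ, q₀, fun σ hσ ↦ hq₀ σ (by rwa [ZpExtension.kerSubgroup_unitTwist] at hσ)⟩
  · rw [two_mul, pow_add]

end Summit.BirchSwinnertonDyer.BirchSwinnertonDyer.Theorems.UniversalToricDescentTwinReadoutLocalIndexThree

end
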